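import Mathlib

/-!
# PercRepro — the type counts of the outside points (night-2, gen 29)

Abstract finset combinatorics for the case-1 assembly (proofs/NIGHT-2-g29.md §4‴ (ii)).  Given a finset `X` (the outside
points) and four predicates `H, A₁, A₂, A₃` (membership in the face closures) with the closure property
`A_b x → A_c x → A_a x` for distinct `a, b, c` (P1, `mem_clF_third_face_of_mem_two`), the outside points split into
the NINE TYPES of `caseOne_finite_check`: in `H` and in no `A` (`n₀`), in `H` and in `A_a` only (`n_a`), off `H` and in
no `A` (`z₀`), off `H` and in `A_a` only (`z_a`), off `H` and in all three (`zA`) — plus the points in `H` and in all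
three, which count nowhere.  Then
* `#{x ∈ X : ¬ H x} = z₀ + z₁ + z₂ + z₃ + zA` (the outside points missed by `H`),
* `#{x ∈ X : ¬ A₁ x} = (n₀ + n₂ + n₃) + (z₀ + z₂ + z₃)` (missed by `A₁`; likewise for `A₂, A₃`),
* `#{x ∈ X : at most one of H x, A₂ x, A₃ x} = n₁ + n₀ + (z₀ + z₁ + z₂ + z₃)` (the good points of the first source;
  likewise for the others).

* `typeCount` (the nine counts as filters), **`card_not_H`**, **`card_not_A₁`**, **`card_good₁`** (and the permuted versions by symmetry).
-/

namespace PercRepro.Shadow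

variable {α : Type*} [DecidableEq α]

section Types

variable (X : Finset α) (H A₁ A₂ A₃ : α → Prop) [DecidablePred H] [DecidablePred A₁] [DecidablePred A₂] [DecidablePred A₃]

/-- The count of the points of `X` with the type `(h, a₁, a₂, a₃)` (membership pattern in `H, A₁, A₂, A₃`). -/
def typeCount (h a₁ a₂ a₃ : Bool) : ℕ :=
  (X.filter (fun x => (decide (H x) = h) ∧ (decide (A₁ x) = a₁) ∧ (decide (A₂ x) = a₂) ∧ (decide (A₃ x) = a₃))).card

end Types

section TypeLemmas

variable {X : Finset α} {H A₁ A₂ A₃ : α → Prop} [DecidablePred H] [DecidablePred A₁] [DecidablePred A₂] [DecidablePred A₃]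

/-- The closure property (P1): a point in two of the `A` is in the third. -/
def ClosureProp (A₁ A₂ A₃ : α → Prop) : Prop :=
  (∀ x, A₂ x → A₃ x → A₁ x) ∧ (∀ x, A₁ x → A₃ x → A₂ x) ∧ (∀ x, A₁ x → A₂ x → A₃ x)

omit [DecidableEq α] in
/-- A filter split by a decidable predicate. -/
theorem card_filter_split (p q : α → Prop) [DecidablePred p] [DecidablePred q] (Y : Finset α) :
    (Y.filter p).card = (Y.filter (fun x => p x ∧ q x)).card + (Y.filter (fun x => p x ∧ ¬ q x)).card := by
  rw [← Finset.filter_filter, ← Finset.filter_filter, Finset.card_filter_add_card_filter_not]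

/-- The points of `X` missed by `H` are the `z`-types. -/
theorem card_not_H (hP : ClosureProp A₁ A₂ A₃) :
    (X.filter (fun x => ¬ H x)).card =
      typeCount X H A₁ A₂ A₃ false false false false + typeCount X H A₁ A₂ A₃ false true false false +
      typeCount X H A₁ A₂ A₃ false false true false + typeCount X H A₁ A₂ A₃ false false false true +
      typeCount X H A₁ A₂ A₃ false true true true := by
  unfold typeCount
  -- every point off `H` has one of the five patterns (by the closure property)
  have hcover : X.filter (fun x => ¬ H x) =
      (X.filter (fun x => decide (H x) = false ∧ decide (A₁ x) = false ∧ decide (A₂ x) = false ∧ decide (A₃ x) = false)) ∪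
      ((X.filter (fun x => decide (H x) = false ∧ decide (A₁ x) = true ∧ decide (A₂ x) = false ∧ decide (A₃ x) = false)) ∪
      ((X.filter (fun x => decide (H x) = false ∧ decide (A₁ x) = false ∧ decide (A₂ x) = true ∧ decide (A₃ x) = false)) ∪
      ((X.filter (fun x => decide (H x) = false ∧ decide (A₁ x) = false ∧ decide (A₂ x) = false ∧ decide (A₃ x) = true)) ∪
      (X.filter (fun x => decide (H x) = false ∧ decide (A₁ x) = true ∧ decide (A₂ x) = true ∧ decide (A₃ x) = true))))) := by
    ext x
    simp only [Finset.mem_filter, Finset.mem_union, decide_eq_false_iff_not, decide_eq_true_eq]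
    constructor
    · rintro ⟨hx, hH⟩
      by_cases h1 : A₁ x <;> by_cases h2 : A₂ x <;> by_cases h3 : A₃ x
      · exact Or.inr (Or.inr (Or.inr (Or.inr ⟨hx, hH, h1, h2, h3⟩)))
      · exact absurd (hP.2.2 x h1 h2) h3
      · exact absurd (hP.2.1 x h1 h3) h2
      · exact Or.inr (Or.inl ⟨hx, hH, h1, h2, h3⟩)
      · exact absurd (hP.1 x h2 h3) h1
      · exact Or.inr (Or.inr (Or.inl ⟨hx, hH, h1, h2, h3⟩))
      · exact Or.inr (Or.inr (Or.inr (Or.inl ⟨hx, hH, h1, h2, h3⟩)))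
      · exact Or.inl ⟨hx, hH, h1, h2, h3⟩
    · rintro (h | h | h | h | h) <;> exact ⟨h.1, h.2.1⟩
  rw [hcover]
  repeat rw [Finset.card_union_of_disjoint]
  · omega
  all_goals
    rw [Finset.disjoint_left]
    intro x hx hx'
    simp only [Finset.mem_filter, Finset.mem_union] at hx hx'
    simp_all


/-- The points of `X` missed by `A₁` are the types off `A₁` (six of them; two `A`'s without the third is impossible). -/
theorem card_not_A₁ (hP : ClosureProp A₁ A₂ A₃) :
    (X.filter (fun x => ¬ A₁ x)).card =
      (typeCount X H A₁ A₂ A₃ true false false false + typeCount X H A₁ A₂ A₃ true false true false +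
        typeCount X H A₁ A₂ A₃ true false false true) +
      (typeCount X H A₁ A₂ A₃ false false false false + typeCount X H A₁ A₂ A₃ false false true false +
        typeCount X H A₁ A₂ A₃ false false false true) := by
  unfold typeCount
  have hcover : X.filter (fun x => ¬ A₁ x) =
      (X.filter (fun x => decide (H x) = true ∧ decide (A₁ x) = false ∧ decide (A₂ x) = false ∧ decide (A₃ x) = false)) ∪
      ((X.filter (fun x => decide (H x) = true ∧ decide (A₁ x) = false ∧ decide (A₂ x) = true ∧ decide (A₃ x) = false)) ∪
      ((X.filter (fun x => decide (H x) = true ∧ decide (A₁ x) = false ∧ decide (A₂ x) = false ∧ decide (A₃ x) = true)) ∪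
      ((X.filter (fun x => decide (H x) = false ∧ decide (A₁ x) = false ∧ decide (A₂ x) = false ∧ decide (A₃ x) = false)) ∪
      ((X.filter (fun x => decide (H x) = false ∧ decide (A₁ x) = false ∧ decide (A₂ x) = true ∧ decide (A₃ x) = false)) ∪
      (X.filter (fun x => decide (H x) = false ∧ decide (A₁ x) = false ∧ decide (A₂ x) = false ∧ decide (A₃ x) = true)))))) := by
    ext x
    simp only [Finset.mem_filter, Finset.mem_union, decide_eq_false_iff_not, decide_eq_true_eq]
    constructor
    · rintro ⟨hx, h1⟩
      by_cases hH : H x <;> by_cases h2 : A₂ x <;> by_cases h3 : A₃ x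
      · exact absurd (hP.1 x h2 h3) h1
      · exact Or.inr (Or.inl ⟨hx, hH, h1, h2, h3⟩)
      · exact Or.inr (Or.inr (Or.inl ⟨hx, hH, h1, h2, h3⟩))
      · exact Or.inl ⟨hx, hH, h1, h2, h3⟩
      · exact absurd (hP.1 x h2 h3) h1
      · exact Or.inr (Or.inr (Or.inr (Or.inr (Or.inl ⟨hx, hH, h1, h2, h3⟩))))
      · exact Or.inr (Or.inr (Or.inr (Or.inr (Or.inr ⟨hx, hH, h1, h2, h3⟩))))
      · exact Or.inr (Or.inr (Or.inr (Or.inl ⟨hx, hH, h1, h2, h3⟩)))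
    · rintro (h | h | h | h | h | h) <;> exact ⟨h.1, h.2.2.1⟩
  rw [hcover]
  repeat rw [Finset.card_union_of_disjoint]
  · omega
  all_goals
    rw [Finset.disjoint_left]
    intro x hx hx'
    simp only [Finset.mem_filter, Finset.mem_union] at hx hx'
    simp_all

/-- The good points of the first source: the points of `X` in at most one of `H, A₂, A₃` are the types
`n₁, n₀, z₀, z₁, z₂, z₃`. -/
theorem card_good₁ (hP : ClosureProp A₁ A₂ A₃) :
    (X.filter (fun x => (decide (H x)).toNat + (decide (A₂ x)).toNat + (decide (A₃ x)).toNat ≤ 1)).card =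
      typeCount X H A₁ A₂ A₃ true true false false + typeCount X H A₁ A₂ A₃ true false false false +
      (typeCount X H A₁ A₂ A₃ false false false false + typeCount X H A₁ A₂ A₃ false true false false +
        typeCount X H A₁ A₂ A₃ false false true false + typeCount X H A₁ A₂ A₃ false false false true) := by
  unfold typeCount
  have hcover : X.filter (fun x => (decide (H x)).toNat + (decide (A₂ x)).toNat + (decide (A₃ x)).toNat ≤ 1) =
      (X.filter (fun x => decide (H x) = true ∧ decide (A₁ x) = true ∧ decide (A₂ x) = false ∧ decide (A₃ x) = false)) ∪
      ((X.filter (fun x => decide (H x) = true ∧ decide (A₁ x) = false ∧ decide (A₂ x) = false ∧ decide (A₃ x) = false)) ∪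
      ((X.filter (fun x => decide (H x) = false ∧ decide (A₁ x) = false ∧ decide (A₂ x) = false ∧ decide (A₃ x) = false)) ∪
      ((X.filter (fun x => decide (H x) = false ∧ decide (A₁ x) = true ∧ decide (A₂ x) = false ∧ decide (A₃ x) = false)) ∪
      ((X.filter (fun x => decide (H x) = false ∧ decide (A₁ x) = false ∧ decide (A₂ x) = true ∧ decide (A₃ x) = false)) ∪
      (X.filter (fun x => decide (H x) = false ∧ decide (A₁ x) = false ∧ decide (A₂ x) = false ∧ decide (A₃ x) = true)))))) := by
    ext x
    simp only [Finset.mem_filter, Finset.mem_union, decide_eq_false_iff_not, decide_eq_true_eq]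
    constructor
    · rintro ⟨hx, hle⟩
      by_cases hH : H x <;> by_cases h1 : A₁ x <;> by_cases h2 : A₂ x <;> by_cases h3 : A₃ x <;> simp_all
      · exact absurd (hP.2.2 x h1 h2) h3
      · exact absurd (hP.2.1 x h1 h3) h2
    · rintro (h | h | h | h | h | h) <;> refine ⟨h.1, ?_⟩ <;> simp_all
  rw [hcover]
  repeat rw [Finset.card_union_of_disjoint]
  · omega
  all_goals
    rw [Finset.disjoint_left]
    intro x hx hx'
    simp only [Finset.mem_filter, Finset.mem_union] at hx hx'
    simp_all

end TypeLemmas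

end PercRepro.Shadow
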